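import Summits.AtomisticToContinuum.HydrodynamicLimit.Theorems.ImplosionDichotomyProfilewiseOfInBand
import Summits.AtomisticToContinuum.HydrodynamicLimit.Theorems.OneFlightGossipEngineClampedTransferDockOfRouteItems
import HarnessLib

/-!
# `HydroLimitProfilewiseBand` (stmt-AtomisticToContinuum-17372) and `HydroLimitInBand` (stmt-9133) from the six ITEMIZED inputs
# of the clamped-transfer dock — the `--glue-by` decls of line `IdeatorOneSketch` v9 / v15 (route ImplosionDichotomy)

Since 2026-08-17T04:29Z every conjecture-grade input of the only checked line of the two packing-guarded hydrodynamic-limit cruxes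
is a route item of `OneFlightGossipEngine` BY NAME, and the binder stmt-17733
`ClampedTransferDockOfInputs := SEET → BandCoherenceLDAlongFamilies → LocalClampedTransferLDAlongFamilies → EnergyActivityTails →
KineticCurrentsLDAlongFamilies → CollisionActivityTails → HydrodynamicLimit` is CLOSED
(`ClampedTransferDockSketch.clampedTransferDockOfInputs_proof`). This file records the two one-line consequences the planners need
to split the cruxes onto the six items (`ledger route edit … --split <Crux> --into … --glue-by <decl>`):

| conjunct | route decl (`Theses.OneFlightGossipEngine.…`) | item |
|---|---|---|
| SEET | `SuperExponentialEnergyTails` | stmt-17701 |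
| BandCoherenceLD | `BandCoherenceLDAlongFamilies` | stmt-17700 |
| LCTF | `LocalClampedTransferLDAlongFamilies` | stmt-17691 |
| CEAT | `EnergyActivityTails` | stmt-17703 |
| KCWF | `KineticCurrentsLDAlongFamilies` | stmt-16659 |
| CAT | `CollisionActivityTails` | stmt-13734 |

* `hydroLimitInBand_of_itemizedInputs` — the uniform band `ImplosionDichotomy.HydroLimitInBand` (stmt-9133; the sub-problem
  Statement `_root_.HydrodynamicLimit` verbatim) from the six items (the registered composition of 9133's line v15);
* `hydroLimitProfilewiseBand_of_itemizedInputs` — the profile-wise crux `ImplosionDichotomy.HydroLimitProfilewiseBand`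
  (stmt-17372) from the six items: `profilewiseOfInBand_proof` (p131525, ∃∀ ⇒ ∀∃) after the former (the registered composition
  `HydroLimitProfilewiseBand_of` of 17372's line v9, `Cruxes/HydroLimitProfilewiseBand/Lines/IdeatorOneSketch.lean`).

Quantifier plumbing over landed theorems only; no statement is weakened or restated. [cite: Yau1991, §2]

prover-line-stmt-AtomisticToContinuum-17372-c6-0 (continuation lead c6, line cycle 7).
-/

noncomputable section

namespace Summit.AtomisticToContinuum.HydrodynamicLimit.Theorems.HydroLimitBandItemizedGlue

open Summit.AtomisticToContinuum.HydrodynamicLimit.Theses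

/-- **The uniform band (stmt-9133) from the six itemized inputs**: the closed binder stmt-17733
(`ClampedTransferDockSketch.clampedTransferDockOfInputs_proof`); `_root_.HydrodynamicLimit` and
`ImplosionDichotomy.HydroLimitInBand` are the same term. [cite: Yau1991, §2] -/
theorem hydroLimitInBand_of_itemizedInputs :
    OneFlightGossipEngine.SuperExponentialEnergyTails → OneFlightGossipEngine.BandCoherenceLDAlongFamilies →
      OneFlightGossipEngine.LocalClampedTransferLDAlongFamilies → OneFlightGossipEngine.EnergyActivityTails →
      OneFlightGossipEngine.KineticCurrentsLDAlongFamilies → OneFlightGossipEngine.CollisionActivityTails →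
      ImplosionDichotomy.HydroLimitInBand :=
  fun hS hB hL hE hK hC => ClampedTransferDockSketch.clampedTransferDockOfInputs_proof hS hB hL hE hK hC

/-- **The profile-wise crux (stmt-17372) from the six itemized inputs**: `profilewiseOfInBand_proof` (stmt-17373, p131525: a
uniform threshold is in particular a profile-wise one, ∃∀ ⇒ ∀∃) after `hydroLimitInBand_of_itemizedInputs`. This is the
registered composition `HydroLimitProfilewiseBand_of` of line `IdeatorOneSketch` v9 of crux 17372 and the `--glue-by` decl for
splitting 17372 six ways onto stmt-17701 / 17700 / 17691 / 17703 / 16659 / 13734. [cite: Yau1991, §2] -/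
theorem hydroLimitProfilewiseBand_of_itemizedInputs :
    OneFlightGossipEngine.SuperExponentialEnergyTails → OneFlightGossipEngine.BandCoherenceLDAlongFamilies →
      OneFlightGossipEngine.LocalClampedTransferLDAlongFamilies → OneFlightGossipEngine.EnergyActivityTails →
      OneFlightGossipEngine.KineticCurrentsLDAlongFamilies → OneFlightGossipEngine.CollisionActivityTails →
      ImplosionDichotomy.HydroLimitProfilewiseBand :=
  fun hS hB hL hE hK hC => profilewiseOfInBand_proof (hydroLimitInBand_of_itemizedInputs hS hB hL hE hK hC)

end Summit.AtomisticToContinuum.HydrodynamicLimit.Theorems.HydroLimitBandItemizedGlue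

end
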